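import Mathlib.LinearAlgebra.Matrix.PosDef

/-!
# `HonestZwanzig.RobinCoercivity`, line LinAlg — stub `stub_gramDualityConverse` (converse Gram duality)

Support file (`--supports` the crux `RobinCoercivity`, stmt-AtomisticToContinuum-12695, of route
`HonestZwanzig`, sub-problem `FouriersLaw`): the converse of the Gram-duality step
(`stub_gramDuality`), making the reduction of the crux to the "flux bound" an equivalence.
Pure finite-dimensional linear algebra over `ℝ`.

If `G, χ` are positive definite `n × n` real matrices, `B` is an `m × n` real matrix and the Schur
complement `χ G⁻¹ χ` is Robin-coercive, `c |B ξ|² ≤ (χ ξ)ᵀ G⁻¹ (χ ξ)` for every `ξ`, then the quadratic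
form of `G` is bounded on every charge/flux pair: `aᵀ G a ≤ c⁻¹ |w|²` whenever `χ a = Bᵀ w`.

Proof (one completed square). Put `ξ := χ⁻¹ G a`, so `χ ξ = G a`. The hypothesis at `ξ` reads
`c |B ξ|² ≤ (G a)ᵀ G⁻¹ (G a) = aᵀ G a`, the cross term is `(B ξ)ᵀ w = ξᵀ Bᵀ w = ξᵀ χ a = (χ ξ)ᵀ a = aᵀ G a`,
and `0 ≤ |c B ξ − w|² = c² |B ξ|² − 2 c (B ξ)ᵀ w + |w|² ≤ c aᵀGa − 2 c aᵀGa + |w|² = |w|² − c aᵀ G a`.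
[folklore]
-/

namespace Summit.AtomisticToContinuum.FouriersLaw.Theorems.HonestZwanzig.Robin

open Matrix

/-- A real positive definite matrix is symmetric: `Gᵀ = G`. [folklore] -/
private theorem transpose_eq_self_of_posDef {n : Type*} [Fintype n] {G : Matrix n n ℝ}
    (hG : G.PosDef) : Gᵀ = G := by
  have h := hG.isHermitian
  rwa [Matrix.IsHermitian, Matrix.conjTranspose_eq_transpose_of_trivial] at h

/-- For a real positive definite (hence symmetric) matrix, `v ⬝ᵥ (G *ᵥ u) = (G *ᵥ v) ⬝ᵥ u`.
[folklore] -/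
private theorem dotProduct_mulVec_comm_of_posDef {n : Type*} [Fintype n] {G : Matrix n n ℝ}
    (hG : G.PosDef) (v u : n → ℝ) : v ⬝ᵥ (G *ᵥ u) = (G *ᵥ v) ⬝ᵥ u := by
  rw [dotProduct_mulVec, ← Matrix.mulVec_transpose, transpose_eq_self_of_posDef hG]

/-- **Converse Gram duality** (one completed square): pure matrix algebra. If the Schur complement
`χ G⁻¹ χ` is Robin-coercive, `c |Bξ|² ≤ (χξ)ᵀ G⁻¹ (χξ)` for every `ξ` (`G, χ` positive definite,
`0 < c`), then `aᵀGa ≤ c⁻¹ |w|²` whenever `χa = Bᵀw`. Together with `stub_gramDuality` this makes the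
crux `RobinCoercivity` EQUIVALENT to the flux bound. [folklore] -/
theorem stub_gramDualityConverse {m n : Type*} [Fintype m] [Fintype n] [DecidableEq n]
    (B : Matrix m n ℝ) (G χ : Matrix n n ℝ) (hG : G.PosDef) (hχ : χ.PosDef) {c : ℝ} (hc : 0 < c)
    (h : ∀ ξ : n → ℝ, c * ((B *ᵥ ξ) ⬝ᵥ (B *ᵥ ξ)) ≤ (χ *ᵥ ξ) ⬝ᵥ (G⁻¹ *ᵥ (χ *ᵥ ξ)))
    (a : n → ℝ) (w : m → ℝ) (haw : χ *ᵥ a = Bᵀ *ᵥ w) :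
    a ⬝ᵥ (G *ᵥ a) ≤ c⁻¹ * (w ⬝ᵥ w) := by
  -- invertibility of `G` and `χ`
  have hGdet : IsUnit G.det := (Matrix.isUnit_iff_isUnit_det G).mp hG.isUnit
  have hχdet : IsUnit χ.det := (Matrix.isUnit_iff_isUnit_det χ).mp hχ.isUnit
  -- the dual test vector `ξ := χ⁻¹ G a`, with `χ ξ = G a`
  set ξ : n → ℝ := χ⁻¹ *ᵥ (G *ᵥ a) with hξ
  have hχξ : χ *ᵥ ξ = G *ᵥ a := by
    rw [hξ, Matrix.mulVec_mulVec, Matrix.mul_nonsing_inv _ hχdet, Matrix.one_mulVec]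
  -- (1) the hypothesis at `ξ`: `c |B ξ|² ≤ (G a)ᵀ G⁻¹ (G a) = aᵀ G a`
  have hGa : G⁻¹ *ᵥ (G *ᵥ a) = a := by
    rw [Matrix.mulVec_mulVec, Matrix.nonsing_inv_mul _ hGdet, Matrix.one_mulVec]
  have h1 : c * ((B *ᵥ ξ) ⬝ᵥ (B *ᵥ ξ)) ≤ a ⬝ᵥ (G *ᵥ a) := by
    have := h ξ
    rwa [hχξ, hGa, dotProduct_comm (G *ᵥ a) a] at this
  -- (2) the cross term `(B ξ)ᵀ w = aᵀ G a`
  have h2 : (B *ᵥ ξ) ⬝ᵥ w = a ⬝ᵥ (G *ᵥ a) := by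
    rw [dotProduct_comm, dotProduct_mulVec, ← Matrix.mulVec_transpose, ← haw,
      ← dotProduct_mulVec_comm_of_posDef hχ, hχξ]
  -- (3) positivity and expansion of the completed square `|c B ξ - w|²`
  have h3 : 0 ≤ (c • (B *ᵥ ξ) - w) ⬝ᵥ (c • (B *ᵥ ξ) - w) :=
    Finset.sum_nonneg fun i _ => mul_self_nonneg _
  have hexp : (c • (B *ᵥ ξ) - w) ⬝ᵥ (c • (B *ᵥ ξ) - w) =
      c * c * ((B *ᵥ ξ) ⬝ᵥ (B *ᵥ ξ)) - 2 * c * ((B *ᵥ ξ) ⬝ᵥ w) + w ⬝ᵥ w := by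
    simp only [dotProduct_sub, sub_dotProduct, dotProduct_smul, smul_dotProduct, smul_eq_mul,
      dotProduct_comm w (B *ᵥ ξ)]
    ring
  rw [hexp, h2] at h3
  -- (4) conclude: `c² |Bξ|² ≤ c aᵀGa`, hence `c aᵀGa ≤ |w|²`
  have h4 : c * (c * ((B *ᵥ ξ) ⬝ᵥ (B *ᵥ ξ))) ≤ c * (a ⬝ᵥ (G *ᵥ a)) :=
    mul_le_mul_of_nonneg_left h1 hc.le
  rw [le_inv_mul_iff₀ hc]
  nlinarith [h3, h4]

end Summit.AtomisticToContinuum.FouriersLaw.Theorems.HonestZwanzig.Robin
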